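import Mathlib
import Literature.NumberTheory.Irrationality.Tosi2026.BasicCellularIntegrals
import Literature.NumberTheory.Transcendental.BeukersZetaThreeIntegralsLegendreProofs
import Literature.Analysis.ValidatedNumerics.TaylorModelLogEdge
import HarnessLib

/-!
# Tosi 2026: the basic cellular integrals `ξ₁ = 1` and `ξ₃ = 2ξ₂ = π²/3` — PROOFS

L. Tosi, *Basic cellular integrals and even zeta values* (arXiv:2601.00346, 2026), Theorem 1
(p. 2), clause (ii): `ξ_{2m+1} = Σ_{h=0}^{m} ξ_{2h} ξ_{2m-2h}` (`m ≥ 1`).  This proofs-only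
companion of `BasicCellularIntegrals.lean` proves UNCONDITIONALLY the two lowest odd instances of
`ξ_l = ∫_{(0,1)^l} dx/((1-x₁x₂)(1-x₂x₃)⋯(1-x_{l-1}x_l))` (`xi`): `xi_one : xi 1 = 1` (empty
product) and `xi_three : xi 3 = π²/3` (`= ξ₀ξ₂ + ξ₂ξ₀ = 2ζ(2)`, clause (ii) at `m = 1`, which the
statement file has only conditionally on the open named fact `theorem1`, as `theorem1.xi_three`;
"Theorem 1 predicts the relation `ξ₃ = 2ξ₂`", §1.3 p. 10; `∫_{Δ₃} ω₃ = 2ζ(2)`, §2.2 p. 18).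
Proof of `xi_three` (elementary, not the paper's): Fubini over the open cube with the middle
coordinate outermost gives `ξ₃ = ∫₀¹ (∫₀¹ dx/(1-xt))² dt = ∫₀¹ (log(1-t)/t)² dt`; after
`t ↦ 1-t` expand `1/(1-u)² = Σ (n+1)uⁿ`, integrate term-wise (`∫₀¹ uⁿ log²u du = 2/(n+1)³`, the
tree's `ValidatedNumerics.PolyMP.integral_pow_mul_log_sq`; absolute convergence) and sum
`Σ 2/(n+1)² = π²/3` (`hasSum_zeta_two`); absolute integrability on the cube by the domination
`1/(1-ab) ≤ (1-a)^{-2/3}(1-b)^{-1/3}` (weighted AM–GM).  The general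
Theorem 1 (all `m`; the arcsine generating series (i); the closed form (iii)) is NOT proved here:
`theorem1` stays an open named fact.
-/

noncomputable section

open MeasureTheory Set Filter Topology

namespace Literature.NumberTheory.Irrationality.Tosi2026

open Literature.NumberTheory.Transcendental

/-! ### `ξ₁ = 1` -/

/-- **`ξ₁ = 1`**: the one-dimensional basic cellular integral has the empty product as
integrand, so `ξ₁ = vol((0,1)) = 1`. [cite: Tosi2026, Introduction p. 2 (definition of `ξ_l`)] -/
theorem xi_one : xi 1 = 1 := by
  have hfun : omegaDensity 1 = fun _ : Fin 1 → ℝ => (1 : ℝ) := by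
    funext x; simp [omegaDensity]
  rw [xi, hfun, show box 1 = {x : Fin 1 → ℝ | ∀ i, x i ∈ Ioo (0 : ℝ) 1} from rfl,
    Beukers.volume_restrict_cube 1, integral_const, smul_eq_mul, mul_one, Measure.real,
    Measure.pi_univ]
  simp

/-! ### The integrand of `ξ₃` and its absolute integrability on the open cube -/

/-- `ω₃` in coordinates: `omegaDensity 3 x = 1/(1 - x₀x₁) · 1/(1 - x₁x₂)`.
[cite: Tosi2026, §1.1 p. 6] -/
theorem omegaDensity_three (x : Fin 3 → ℝ) :
    omegaDensity 3 x = 1 / (1 - x 0 * x 1) * (1 / (1 - x 1 * x 2)) := by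
  rw [omegaDensity, Fin.prod_univ_three]
  have h0 : (0 : Fin 3).1 + 1 < 3 := by decide
  have h1 : (1 : Fin 3).1 + 1 < 3 := by decide
  have h2 : ¬ ((2 : Fin 3).1 + 1 < 3) := by decide
  rw [dif_pos h0, dif_pos h1, dif_neg h2, mul_one]
  rfl

/-- For `a, b ∈ (0,1)`: `0 < 1 - ab`. [folklore] -/
private theorem one_sub_mul_pos_of_mem_Ioo {a b : ℝ} (ha : a ∈ Ioo (0 : ℝ) 1) (hb : b ∈ Ioo (0 : ℝ) 1) :
    0 < 1 - a * b := by
  nlinarith [ha.1, ha.2, hb.1, hb.2]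

/-- **Weighted AM–GM domination**: for `a, b ∈ (0,1)`, `1/(1 - ab) ≤ (1-a)^{-2/3} (1-b)^{-1/3}`
(since `(1-a)^{2/3}(1-b)^{1/3} ≤ (2/3)(1-a) + (1/3)(1-b) ≤ 1 - ab`). [folklore] -/
private theorem one_div_one_sub_mul_le_rpow {a b : ℝ} (ha : a ∈ Ioo (0 : ℝ) 1) (hb : b ∈ Ioo (0 : ℝ) 1) :
    1 / (1 - a * b) ≤ (1 - a) ^ (-(2 / 3 : ℝ)) * (1 - b) ^ (-(1 / 3 : ℝ)) := by
  have h1a : 0 < 1 - a := by linarith [ha.2]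
  have h1b : 0 < 1 - b := by linarith [hb.2]
  have hamgm : (1 - a) ^ (2 / 3 : ℝ) * (1 - b) ^ (1 / 3 : ℝ) ≤
      (2 / 3) * (1 - a) + (1 / 3) * (1 - b) :=
    Real.geom_mean_le_arith_mean2_weighted (by norm_num) (by norm_num) h1a.le h1b.le (by norm_num)
  have hle : (1 - a) ^ (2 / 3 : ℝ) * (1 - b) ^ (1 / 3 : ℝ) ≤ 1 - a * b := by
    have : (2 / 3 : ℝ) * (1 - a) + (1 / 3) * (1 - b) ≤ 1 - a * b := by
      nlinarith [ha.1, ha.2, hb.1, hb.2]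
    exact hamgm.trans this
  have hpos : 0 < (1 - a) ^ (2 / 3 : ℝ) * (1 - b) ^ (1 / 3 : ℝ) :=
    mul_pos (Real.rpow_pos_of_pos h1a _) (Real.rpow_pos_of_pos h1b _)
  calc 1 / (1 - a * b) ≤ 1 / ((1 - a) ^ (2 / 3 : ℝ) * (1 - b) ^ (1 / 3 : ℝ)) :=
        one_div_le_one_div_of_le hpos hle
    _ = (1 - a) ^ (-(2 / 3 : ℝ)) * (1 - b) ^ (-(1 / 3 : ℝ)) := by
        rw [Real.rpow_neg h1a.le, Real.rpow_neg h1b.le, one_div, mul_inv]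

/-- `(1-x)^r` is integrable on `(0,1)` for `r > -1`. [folklore] -/
private theorem integrableOn_Ioo_one_sub_rpow {r : ℝ} (hr : -1 < r) :
    IntegrableOn (fun x : ℝ => (1 - x) ^ r) (Ioo (0 : ℝ) 1) := by
  have h := (intervalIntegral.intervalIntegrable_rpow' (a := (1 : ℝ)) (b := 0) hr).comp_sub_left 1
  simp only [sub_self, sub_zero] at h
  exact (intervalIntegrable_iff_integrableOn_Ioo_of_le zero_le_one).mp h

/-- **Absolute integrability of `ω₃` on the open cube** (dominated by the integrable product
`(1-x₀)^{-2/3}(1-x₁)^{-2/3}(1-x₂)^{-2/3}`). [folklore] -/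
private theorem integrableOn_omegaDensity_three :
    IntegrableOn (fun p : Fin 3 → ℝ => 1 / (1 - p 0 * p 1) * (1 / (1 - p 1 * p 2)))
      {p : Fin 3 → ℝ | ∀ j, p j ∈ Ioo (0 : ℝ) 1} := by
  have hr : (-1 : ℝ) < -(2 / 3 : ℝ) := by norm_num
  have hG : IntegrableOn (fun p : Fin 3 → ℝ =>
      (1 - p 0) ^ (-(2 / 3 : ℝ)) * (1 - p 1) ^ (-(2 / 3 : ℝ)) * (1 - p 2) ^ (-(2 / 3 : ℝ)))
      {p : Fin 3 → ℝ | ∀ j, p j ∈ Ioo (0 : ℝ) 1} := by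
    rw [IntegrableOn, Beukers.volume_restrict_cube]
    have hprod := Integrable.fintype_prod (f := fun (_ : Fin 3) (x : ℝ) => (1 - x) ^ (-(2 / 3 : ℝ)))
      (μ := fun _ : Fin 3 => (volume : Measure ℝ).restrict (Ioo 0 1))
      (fun _ => integrableOn_Ioo_one_sub_rpow hr)
    have hfun : (fun p : Fin 3 → ℝ =>
        (1 - p 0) ^ (-(2 / 3 : ℝ)) * (1 - p 1) ^ (-(2 / 3 : ℝ)) * (1 - p 2) ^ (-(2 / 3 : ℝ))) =
        fun p => ∏ i : Fin 3, (1 - p i) ^ (-(2 / 3 : ℝ)) := by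
      funext p; simp [Fin.prod_univ_three, mul_assoc]
    rw [hfun]; exact hprod
  have hFc : ContinuousOn (fun p : Fin 3 → ℝ => 1 / (1 - p 0 * p 1) * (1 / (1 - p 1 * p 2)))
      {p : Fin 3 → ℝ | ∀ j, p j ∈ Ioo (0 : ℝ) 1} := by
    refine ContinuousOn.mul ?_ ?_
    · exact continuousOn_const.div (Continuous.continuousOn (by fun_prop))
        fun p hp => (one_sub_mul_pos_of_mem_Ioo (hp 0) (hp 1)).ne'
    · exact continuousOn_const.div (Continuous.continuousOn (by fun_prop))
        fun p hp => (one_sub_mul_pos_of_mem_Ioo (hp 1) (hp 2)).ne'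
  refine Integrable.mono' hG (hFc.aestronglyMeasurable (Beukers.measurableSet_cube 3)) ?_
  refine (ae_restrict_iff' (Beukers.measurableSet_cube 3)).2 (ae_of_all _ fun p hp => ?_)
  have hA := one_div_one_sub_mul_le_rpow (hp 0) (hp 1)
  have hB := one_div_one_sub_mul_le_rpow (hp 2) (hp 1)
  rw [mul_comm (p 2) (p 1), mul_comm ((1 - p 2) ^ (-(2 / 3 : ℝ)))] at hB
  have h1b : 0 < 1 - p 1 := by linarith [(hp 1).2]
  have hApos : 0 < 1 / (1 - p 0 * p 1) :=
    one_div_pos.mpr (one_sub_mul_pos_of_mem_Ioo (hp 0) (hp 1))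
  have hBpos : 0 < 1 / (1 - p 1 * p 2) :=
    one_div_pos.mpr (one_sub_mul_pos_of_mem_Ioo (hp 1) (hp 2))
  rw [Real.norm_eq_abs, abs_of_pos (mul_pos hApos hBpos)]
  calc 1 / (1 - p 0 * p 1) * (1 / (1 - p 1 * p 2))
      ≤ ((1 - p 0) ^ (-(2 / 3 : ℝ)) * (1 - p 1) ^ (-(1 / 3 : ℝ))) *
          ((1 - p 1) ^ (-(1 / 3 : ℝ)) * (1 - p 2) ^ (-(2 / 3 : ℝ))) :=
        mul_le_mul hA hB hBpos.le ((le_of_lt hApos).trans hA)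
    _ = (1 - p 0) ^ (-(2 / 3 : ℝ)) * (1 - p 1) ^ (-(2 / 3 : ℝ)) *
          (1 - p 2) ^ (-(2 / 3 : ℝ)) := by
        have h2 : (1 - p 1) ^ (-(2 / 3 : ℝ)) =
            (1 - p 1) ^ (-(1 / 3 : ℝ)) * (1 - p 1) ^ (-(1 / 3 : ℝ)) := by
          rw [← Real.rpow_add h1b]; norm_num
        rw [h2]; ring

/-! ### Fubini with one coordinate outermost, and the inner square integral -/

/-- **Fubini over the open unit cube, one coordinate outermost**: for `F` integrable on the open
unit cube of `ℝ³`, `∫ F = ∫_{t ∈ (0,1)} ∫_{q ∈ (0,1)²} F(insertNth i t q)`. [folklore] -/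
private theorem integral_cube_eq_integral_Ioo_integral_square (i : Fin 3) (F : (Fin 3 → ℝ) → ℝ)
    (hF : IntegrableOn F {p : Fin 3 → ℝ | ∀ j, p j ∈ Ioo (0 : ℝ) 1}) :
    ∫ p in {p : Fin 3 → ℝ | ∀ j, p j ∈ Ioo (0 : ℝ) 1}, F p =
      ∫ t in Ioo (0 : ℝ) 1, ∫ q in {q : Fin 2 → ℝ | ∀ j, q j ∈ Ioo (0 : ℝ) 1},
        F (i.insertNth t q) := by
  rw [IntegrableOn, Beukers.volume_restrict_cube] at hF
  rw [Beukers.volume_restrict_cube, Beukers.volume_restrict_cube]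
  have hmp := (measurePreserving_piFinSuccAbove
    (fun _ : Fin 3 => (volume : Measure ℝ).restrict (Ioo 0 1)) i).symm
  rw [← hmp.integrable_comp_emb (MeasurableEquiv.measurableEmbedding _)] at hF
  rw [← hmp.integral_comp']
  exact integral_prod _ hF

/-- `∫_{(0,1)} dz/(1 - az) = -log(1-a)/a` for `0 < a < 1`, as a set integral (the tree's
`Beukers.integral_one_div_one_sub_mul`). [folklore] -/
private theorem setIntegral_Ioo_one_div_one_sub_mul {a : ℝ} (ha0 : 0 < a) (ha1 : a < 1) :
    ∫ z in Ioo (0 : ℝ) 1, 1 / (1 - a * z) = -Real.log (1 - a) / a := by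
  rw [← Beukers.integral_one_div_one_sub_mul ha0 ha1, intervalIntegral.integral_of_le zero_le_one,
    integral_Ioc_eq_integral_Ioo]

/-- **The slice integral**: for `t ∈ (0,1)`, the integral of `ω₃` over the square `x₁ = t` is the
product `(∫₀¹ dx/(1-xt)) (∫₀¹ dy/(1-ty)) = (log(1-t)/t)²`. [folklore] -/
private theorem setIntegral_square_omegaDensity_three_slice {t : ℝ} (ht : t ∈ Ioo (0 : ℝ) 1) :
    ∫ q in {q : Fin 2 → ℝ | ∀ j, q j ∈ Ioo (0 : ℝ) 1},
        (fun p : Fin 3 → ℝ => 1 / (1 - p 0 * p 1) * (1 / (1 - p 1 * p 2)))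
          ((1 : Fin 3).insertNth t q) = (Real.log (1 - t) / t) ^ 2 := by
  have hfun : (fun q : Fin 2 → ℝ =>
      (fun p : Fin 3 → ℝ => 1 / (1 - p 0 * p 1) * (1 / (1 - p 1 * p 2)))
        ((1 : Fin 3).insertNth t q)) =
      fun q => ∏ i : Fin 2, (fun y : ℝ => 1 / (1 - t * y)) (q i) := by
    funext q
    simp only [Beukers.insertNth_one_eq]; simp [Fin.prod_univ_two, mul_comm]
  rw [Beukers.volume_restrict_cube 2, hfun]
  have h := integral_fintype_prod_eq_pow (ι := Fin 2) (fun y : ℝ => 1 / (1 - t * y))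
    (μ := (volume : Measure ℝ).restrict (Ioo (0 : ℝ) 1))
  rw [Fintype.card_fin, setIntegral_Ioo_one_div_one_sub_mul ht.1 ht.2] at h
  exact h.trans (by ring)

/-! ### The one-variable integrals `∫_{(0,1)} log²u · (n+1)uⁿ du = 2/(n+1)²` -/

/-- `∫_{(0,1)} log²u · ((n+1) uⁿ) du = 2/(n+1)²`, as a set integral (from the tree's
`∫₀ᴸ sᵃ log²s ds`, `ValidatedNumerics.PolyMP.integral_pow_mul_log_sq`, at `L = 1`). [folklore] -/
private theorem setIntegral_Ioo_log_sq_mul (n : ℕ) :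
    ∫ u in Ioo (0 : ℝ) 1, Real.log u ^ 2 * (((n : ℝ) + 1) * u ^ n) = 2 / ((n : ℝ) + 1) ^ 2 := by
  have hc0 : (0 : ℝ) < (n : ℝ) + 1 := by positivity
  have hfun : (fun u : ℝ => Real.log u ^ 2 * (((n : ℝ) + 1) * u ^ n)) =
      fun u => ((n : ℝ) + 1) * (u ^ n * Real.log u ^ 2) := by
    funext u; ring
  rw [hfun, integral_const_mul, ← integral_Ioc_eq_integral_Ioo,
    ← intervalIntegral.integral_of_le zero_le_one,
    Literature.Analysis.ValidatedNumerics.PolyMP.integral_pow_mul_log_sq n one_pos le_rfl]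
  simp only [one_pow, Real.log_one, one_mul]
  field_simp
  ring

/-- `log²u · ((n+1) uⁿ)` is integrable on `(0,1)`. [folklore] -/
private theorem integrableOn_Ioo_log_sq_mul (n : ℕ) :
    IntegrableOn (fun u : ℝ => Real.log u ^ 2 * (((n : ℝ) + 1) * u ^ n)) (Ioo (0 : ℝ) 1) := by
  have h : IntegrableOn (fun u : ℝ => ((n : ℝ) + 1) * (u ^ n * Real.log u ^ 2))
      (Ioo (0 : ℝ) 1) :=
    ((intervalIntegrable_iff_integrableOn_Ioo_of_le zero_le_one).mp
      (Literature.Analysis.ValidatedNumerics.PolyMP.intervalIntegrable_pow_mul_log_sq n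
        zero_le_one le_rfl)).const_mul ((n : ℝ) + 1)
  refine h.congr_fun (fun u _ => ?_) measurableSet_Ioo
  ring

/-! ### `∫₀¹ (log u/(1-u))² du = π²/3` by term-wise integration -/

/-- On `(0,1)`: `(log u/(1-u))² = Σₙ log²u · (n+1)uⁿ`. [folklore] -/
private theorem hasSum_log_sq_mul {u : ℝ} (hu : u ∈ Ioo (0 : ℝ) 1) :
    HasSum (fun n : ℕ => Real.log u ^ 2 * (((n : ℝ) + 1) * u ^ n))
      ((Real.log u / (1 - u)) ^ 2) := by
  have hnorm : ‖u‖ < 1 := by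
    rw [Real.norm_eq_abs, abs_lt]
    exact ⟨by linarith [hu.1], hu.2⟩
  have h := hasSum_choose_mul_geometric_of_norm_lt_one 1 hnorm
  simp only [Nat.choose_one_right, Nat.cast_add, Nat.cast_one] at h
  have h2 := h.mul_left (Real.log u ^ 2)
  have hval : Real.log u ^ 2 * (1 / (1 - u) ^ (1 + 1)) = (Real.log u / (1 - u)) ^ 2 := by
    rw [div_pow]; ring
  rwa [hval] at h2

/-- `Σₙ 2/(n+1)² = π²/3` (twice `ζ(2) = π²/6`, `hasSum_zeta_two`). [folklore] -/
private theorem hasSum_two_div_succ_sq :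
    HasSum (fun n : ℕ => 2 / ((n : ℝ) + 1) ^ 2) (Real.pi ^ 2 / 3) := by
  have hz := (hasSum_nat_add_iff' 1).mpr hasSum_zeta_two
  simp only [Finset.sum_range_one, Nat.cast_zero, ne_eq, OfNat.ofNat_ne_zero, not_false_eq_true,
    zero_pow, div_zero, sub_zero] at hz
  have h2 := hz.mul_left 2
  have hval : (2 : ℝ) * (Real.pi ^ 2 / 6) = Real.pi ^ 2 / 3 := by ring
  rw [hval] at h2
  refine h2.congr_fun fun n => ?_
  push_cast
  ring

/-- **`∫_{(0,1)} (log u/(1-u))² du = π²/3`** (term-wise integration of the nonnegative series,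
`MeasureTheory.hasSum_integral_of_summable_integral_norm`). [folklore] -/
private theorem setIntegral_Ioo_log_div_one_sub_sq :
    ∫ u in Ioo (0 : ℝ) 1, (Real.log u / (1 - u)) ^ 2 = Real.pi ^ 2 / 3 := by
  have hnorm : ∀ n : ℕ, ∫ u in Ioo (0 : ℝ) 1, ‖Real.log u ^ 2 * (((n : ℝ) + 1) * u ^ n)‖ =
      2 / ((n : ℝ) + 1) ^ 2 := by
    intro n
    rw [← setIntegral_Ioo_log_sq_mul n]
    exact setIntegral_congr_fun measurableSet_Ioo fun u hu =>
      Real.norm_of_nonneg (mul_nonneg (sq_nonneg _)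
        (mul_nonneg (by positivity) (pow_nonneg hu.1.le n)))
  have hsum : Summable fun n : ℕ =>
      ∫ u in Ioo (0 : ℝ) 1, ‖Real.log u ^ 2 * (((n : ℝ) + 1) * u ^ n)‖ := by
    simp_rw [hnorm]
    exact hasSum_two_div_succ_sq.summable
  have h := hasSum_integral_of_summable_integral_norm
    (μ := volume.restrict (Ioo (0 : ℝ) 1))
    (F := fun (n : ℕ) (u : ℝ) => Real.log u ^ 2 * (((n : ℝ) + 1) * u ^ n))
    (integrableOn_Ioo_log_sq_mul) hsum
  have hlhs : ∫ u in Ioo (0 : ℝ) 1, (Real.log u / (1 - u)) ^ 2 =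
      ∫ u in Ioo (0 : ℝ) 1, ∑' n : ℕ, Real.log u ^ 2 * (((n : ℝ) + 1) * u ^ n) :=
    setIntegral_congr_fun measurableSet_Ioo fun u hu => ((hasSum_log_sq_mul hu).tsum_eq).symm
  rw [hlhs]
  have hterms : (fun n : ℕ => ∫ u in Ioo (0 : ℝ) 1, Real.log u ^ 2 * (((n : ℝ) + 1) * u ^ n)) =
      fun n : ℕ => 2 / ((n : ℝ) + 1) ^ 2 := funext fun n => setIntegral_Ioo_log_sq_mul n
  have h' : HasSum (fun n : ℕ => 2 / ((n : ℝ) + 1) ^ 2)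
      (∫ u in Ioo (0 : ℝ) 1, ∑' n : ℕ, Real.log u ^ 2 * (((n : ℝ) + 1) * u ^ n)) := by
    rw [← hterms]
    exact h
  exact h'.unique hasSum_two_div_succ_sq

/-- Reflection `t ↦ 1 - t` of a set integral over `(0,1)`. [folklore] -/
private theorem setIntegral_Ioo_comp_one_sub (f : ℝ → ℝ) :
    ∫ t in Ioo (0 : ℝ) 1, f (1 - t) = ∫ t in Ioo (0 : ℝ) 1, f t := by
  have h := intervalIntegral.integral_comp_sub_left (a := (0 : ℝ)) (b := 1) f 1
  simp only [sub_self, sub_zero] at h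
  rw [intervalIntegral.integral_of_le zero_le_one, intervalIntegral.integral_of_le zero_le_one,
    integral_Ioc_eq_integral_Ioo, integral_Ioc_eq_integral_Ioo] at h
  exact h

/-- **`∫_{(0,1)} (log(1-t)/t)² dt = π²/3`.** [folklore] -/
private theorem setIntegral_Ioo_log_one_sub_div_sq :
    ∫ t in Ioo (0 : ℝ) 1, (Real.log (1 - t) / t) ^ 2 = Real.pi ^ 2 / 3 := by
  have h := setIntegral_Ioo_comp_one_sub (fun u => (Real.log u / (1 - u)) ^ 2)
  simp only [sub_sub_cancel] at h
  exact h.trans setIntegral_Ioo_log_div_one_sub_sq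

/-! ### `ξ₃ = π²/3` -/

/-- **`ξ₃ = 2ξ₂ = 2ζ(2) = π²/3`** — Theorem 1 (ii) at `m = 1` (`ξ₃ = ξ₀ξ₂ + ξ₂ξ₀`), proved
unconditionally: Fubini with the middle coordinate outermost, `ξ₃ = ∫₀¹ (log(1-t)/t)² dt`, and the
term-wise evaluation above.  "Theorem 1 predicts the relation `ξ₃ = 2ξ₂`";
`∫_{Δ₃} ω₃ = ζ(2) + Li₂(1) = 2ζ(2)`.
[cite: Tosi2026, Theorem 1 (ii), p. 2; §1.3 p. 10; §2.2 p. 18] -/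
theorem xi_three : xi 3 = Real.pi ^ 2 / 3 := by
  have hfun : omegaDensity 3 =
      fun p : Fin 3 → ℝ => 1 / (1 - p 0 * p 1) * (1 / (1 - p 1 * p 2)) :=
    funext omegaDensity_three
  rw [xi, hfun, show box 3 = {x : Fin 3 → ℝ | ∀ i, x i ∈ Ioo (0 : ℝ) 1} from rfl,
    integral_cube_eq_integral_Ioo_integral_square 1 _ integrableOn_omegaDensity_three,
    ← setIntegral_Ioo_log_one_sub_div_sq]
  exact setIntegral_congr_fun measurableSet_Ioo fun t ht =>
    setIntegral_square_omegaDensity_three_slice ht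

end Literature.NumberTheory.Irrationality.Tosi2026

end
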